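import Mathlib
import Summits.NavierStokesRegularity.NavierStokesRegularity.Theorems.SubOnsagerCeilingKPStarvedNetworkFlux
import Summits.NavierStokesRegularity.NavierStokesRegularity.Theorems.SubOnsagerCeilingKPBarrierCurrency
import Summits.NavierStokesRegularity.NavierStokesRegularity.Theorems.SubcriticalEnvelopeForwardSourceTailEnvelopeKPDyadicRatioTwo
import HarnessLib

/-!
# STARVED NETWORKS, GENERAL FORM — the starved gate fluxes and the ν-uniform shell barrier (part 3 of 3)
# (helper file for the crux `SubOnsagerCeiling.ForwardTailCeilingKP`, stmt-NavierStokesRegularity-27057, `--supports`)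

THE CLASS (def-free, coefficient hypotheses on a KP network proper `α ∈ E₂(R)` — symmetric, cancelling, orthant, diagonal feeds; see
`Theorems/SubOnsagerCeilingKPStarvedNetworkStarvation.lean`): a set `Q` of POCKETS, forward-dead (`α d d e (0,0,1) = 0`) and pump-dead
(`P d e = 0`, `P a e := α a a e (0,0,0)` the pump matrix); the LIVE modes `∉ Q` carry ANY diagonal forward network among themselves, LEAK
forward into the pockets (`w_{ad} = α a a d (0,0,1)`) and PUMP in-shell into the pockets (`P a d`), pump nothing else, and there are no
differential triads.  GRAM DOMINATION: `r·Σ_{e∉Q} w_{ae}w_{ce} ≤ Σ_{d∈Q} (P a d·P c d + w_{ad}w_{cd})` for all live `a, c`.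

* `starved_gateFlux_le` — `∫₀ᵗ OUT_m ≤ E₀·(1+r)·q^m`, `q = (1+r)⁻¹`, every gate `m : ℕ` (parts 1–2 + the class-wide flux budget);
* `starvedNetwork_shellBarrierAt` — **ENERGY STARVATION BARRIER, GENERAL FORM**: `r > ε₀ ⇒ ShellBarrierAt R ε₀ α` with
  `(1+ε₀)^{2θ} = 1 + r`, `D = (1+r)²`, at EVERY scale ratio `1 + ε₀ > 1` (band bound `kpProper_bandEnergy_le_gateFlux`);
* `starvedNetwork_ceilingAt`, `starvedNetwork_primaryGraded` — the same in the currencies `CeilingAt` and the registered stubs' body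
  `PrimaryGradedAt` (through `kpPrimaryGraded_of_shellBarrierAt`).

This single theorem contains every energy-starvation corner landed before it — dead-end pump (`Q = {1}`, `r = P²/c₀²`), leak spray and
exit spray (`Q` = the dead ends, one live chain), re-entry pair with exits, shared pocket fed by pumps (`Q = {3}`, `ρ w ≤ P`, `κ Σw ≤ P`
⇒ Gram with `r = ρκ`), shared pocket fed by leaks — and adds: several pockets at once, pumps AND leaks at once, and the symmetric Gram
condition in place of the termwise ones (item R6 of the remaining list of leafhand-2, 2026-08-31).
HONEST FRAMING: statements about Tao-type MODEL lattice ODEs (route SubOnsagerCeiling, rung TL-M2Break); a corner of the registered stubs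
`stub_primaryGradedLargeRatio` / `stub_primaryGradedSmallRatio` valid in both ratio regimes, not the stubs; no crux or summit is proved and
nothing here bears on Navier–Stokes regularity. [cite: Tao2016AveragedNS, §4 (4.2)–(4.3), (4.8)–(4.9), (4.13)]
[cite: BarbatoMorandinRomito2011, §3.2 (shape of the barrier)]
-/

noncomputable section

-- the sub-problem namespace `NavierStokesRegularity.NavierStokesRegularity` is the tree's layout (D-0017)
set_option linter.dupNamespace false

namespace Summit.NavierStokesRegularity.NavierStokesRegularity.Theorems

open Set Finset MeasureTheory intervalIntegral
open scoped Topology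
open Literature.Analysis.FluidPDE.TaoCascade
open Summit.NavierStokesRegularity.NavierStokesRegularity.Theorems.SubOnsagerCeiling

section StarvedNetworkGate

variable {α : Fin 4 → Fin 4 → Fin 4 → ℤ × ℤ × ℤ → ℝ} {P : Fin 4 → Fin 4 → ℝ} {Q : Finset (Fin 4)}
  (hs : IsSymmetricCoeff α) (hc : IsCancellingCoeff α)
  (hO : ∀ (Y : Fin 4 → ℤ → ℝ → ℝ) (τ : ℝ), (∀ (j : Fin 4) (k : ℤ), 1 ≤ k → 0 ≤ Y j k τ) →
    ∀ δ : ℝ, 0 < δ → ∀ (i : Fin 4) (n : ℤ), 1 ≤ n → Y i n τ = 0 → 0 ≤ quadTerm δ α Y i n τ)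
  (hD : ∀ a b i : Fin 4, a ≠ b → α a b i (0, 0, 1) = 0)
  (hPump : ∀ a d : Fin 4, α a a d (0, 0, 0) = P a d)
  (hCz : ∀ a b d : Fin 4, a ≠ b → a ≠ d → b ≠ d → α a b d (0, 0, 0) = 0)
  (hQw : ∀ d ∈ Q, ∀ e : Fin 4, α d d e (0, 0, 1) = 0)
  (hQP : ∀ d ∈ Q, ∀ j : Fin 4, P d j = 0)
  (hPQ : ∀ a j : Fin 4, j ∉ Q → P a j = 0)
include hs hc hO hD hPump hCz hQw hQP hPQ

/-- **THE STARVED GATE FLUXES**: `∫₀ᵗ OUT_m ≤ E₀·(1+r)·q^m` for every `m : ℕ` (`m = 0`: the flux budget; `m ≥ 1`: `OUT_m ≤ LIN_m = LOUT_{m-1}`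
by the live balance, the pump work being `≥ 0`). MODEL lattice statement. [cite: Tao2016AveragedNS, §4 (4.8)–(4.9), (4.13)] -/
theorem starved_gateFlux_le {ε₀ ν s r : ℝ} (hε : 0 ≤ ε₀) (hν : 0 ≤ ν) (hr0 : 0 ≤ r) (hPnn : ∀ a d, 0 ≤ P a d)
    (hGram : ∀ a c : Fin 4, a ∉ Q → c ∉ Q →
      r * ∑ e ∈ Qᶜ, α a a e (0, 0, 1) * α c c e (0, 0, 1) ≤
        ∑ d ∈ Q, (P a d * P c d + α a a d (0, 0, 1) * α c c d (0, 0, 1)))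
    {X₀ : Fin 4 → ℝ} {X : Fin 4 → ℤ → ℝ → ℝ}
    (hdat : ∀ (i : Fin 4) (k : ℤ), X i k 0 = if k = 0 then X₀ i else 0)
    (hvan : ∀ (i : Fin 4) (k : ℤ), k < 0 → ∀ t : ℝ, X i k t = 0)
    (hXc : ∀ (i : Fin 4) (k : ℤ), Continuous (X i k))
    (hode : ∀ (i : Fin 4) (k : ℤ), ∀ t ∈ Icc (0 : ℝ) s, HasDerivWithinAt (X i k)
      (quadTerm ε₀ α X i k t - ν * (1 + ε₀) ^ ((2 : ℝ) * k) * X i k t) (Icc (0 : ℝ) s) t)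
    (hnn : ∀ t ∈ Icc (0 : ℝ) s, ∀ (i : Fin 4) (k : ℤ), 1 ≤ k → 0 ≤ X i k t) :
    ∀ m : ℕ, ∀ t ∈ Icc (0 : ℝ) s,
      ∫ τ in (0 : ℝ)..t, (1 + ε₀) ^ ((5 : ℝ) * (m : ℝ) / 2) *
          ∑ i, ∑ j, α i i j (0, 0, 1) * X i (m : ℤ) τ ^ 2 * X j ((m : ℤ) + 1) τ ≤
        (∑ i, (1 / 2 : ℝ) * X₀ i ^ 2) * (1 + r) * ((1 + r)⁻¹) ^ m := by
  have hr : 0 < 1 + r := by positivity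
  have hb : (0 : ℝ) < 1 + ε₀ := by linarith
  have hE₀ : 0 ≤ ∑ i, (1 / 2 : ℝ) * X₀ i ^ 2 := Finset.sum_nonneg fun i _ => by positivity
  intro m
  cases m with
  | zero =>
    intro t ht
    have h := kpProper_bondFlux_budget hs hc hO hD hb hν hdat hvan hXc hode 0 t ht
    have h1 : (∑ i, (1 / 2 : ℝ) * X₀ i ^ 2) ≤ (∑ i, (1 / 2 : ℝ) * X₀ i ^ 2) * (1 + r) * ((1 + r)⁻¹) ^ 0 := by
      rw [pow_zero, mul_one]
      nlinarith
    exact h.trans h1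
  | succ m =>
    intro t ht
    have hn : (1 : ℤ) ≤ (m : ℤ) + 1 := by omega
    have hbal := starved_live_balance hs hc hO hD hPump hCz hQw hQP hPQ hε hν hdat hXc hode hn t ht
    -- the pump work is `≥ 0`
    have hpump : 0 ≤ ∫ τ in (0 : ℝ)..t, (1 + ε₀) ^ ((5 : ℝ) * (((m : ℤ) + 1 : ℤ) : ℝ) / 2) *
        ∑ i, X i ((m : ℤ) + 1) τ ^ 2 * ∑ d, P i d * X d ((m : ℤ) + 1) τ := by
      refine intervalIntegral.integral_nonneg ht.1 fun u hu => ?_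
      have hus : u ∈ Icc (0 : ℝ) s := ⟨hu.1, hu.2.trans ht.2⟩
      exact mul_nonneg (Real.rpow_nonneg hb.le _) (Finset.sum_nonneg fun i _ => mul_nonneg (sq_nonneg _)
        (Finset.sum_nonneg fun d _ => mul_nonneg (hPnn i d) (hnn u hus d _ hn)))
    -- the live in-flux of shell `m+1` is the live out-flux of gate `m`
    have hin : ∫ τ in (0 : ℝ)..t, (1 + ε₀) ^ ((5 : ℝ) * ((((m : ℤ) + 1 : ℤ) : ℝ) - 1) / 2) *
          ∑ e ∈ Qᶜ, ∑ a, α a a e (0, 0, 1) * X a ((m : ℤ) + 1 - 1) τ ^ 2 * X e ((m : ℤ) + 1) τ =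
        ∫ τ in (0 : ℝ)..t, (1 + ε₀) ^ ((5 : ℝ) * (m : ℝ) / 2) *
          ∑ i, ∑ j ∈ Qᶜ, α i i j (0, 0, 1) * X i (m : ℤ) τ ^ 2 * X j ((m : ℤ) + 1) τ := by
      refine intervalIntegral.integral_congr fun τ _ => ?_
      have h := (starved_liveOut_eq_liveIn_succ (α := α) (Q := Q) ε₀ X (m : ℤ) τ).symm
      have hc' : ((5 : ℝ) * (((m : ℤ) : ℤ) : ℝ) / 2) = (5 : ℝ) * (m : ℝ) / 2 := by push_cast; ring
      simpa [hc'] using h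
    rw [hin] at hbal
    have hlive := starved_liveFlux_le hs hc hO hD hPump hCz hQw hQP hPQ hε hν hr0 hPnn hGram hdat hvan hXc hode hnn m t ht
    have hcast1 : (((m + 1 : ℕ) : ℝ)) = (((m : ℤ) + 1 : ℤ) : ℝ) := by push_cast; ring
    have hcast2 : (((m + 1 : ℕ) : ℤ)) = (m : ℤ) + 1 := by push_cast; ring
    rw [hcast1, hcast2]
    have heq : (∑ i, (1 / 2 : ℝ) * X₀ i ^ 2) * ((1 + r)⁻¹) ^ m =
        (∑ i, (1 / 2 : ℝ) * X₀ i ^ 2) * (1 + r) * ((1 + r)⁻¹) ^ (m + 1) := by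
      rw [pow_succ, show (∑ i, (1 / 2 : ℝ) * X₀ i ^ 2) * (1 + r) * (((1 + r)⁻¹) ^ m * (1 + r)⁻¹) =
        (∑ i, (1 / 2 : ℝ) * X₀ i ^ 2) * ((1 + r)⁻¹) ^ m * ((1 + r) * (1 + r)⁻¹) by ring,
        mul_inv_cancel₀ hr.ne', mul_one]
    linarith


end StarvedNetworkGate

/-! ## The barrier -/

/-- **ENERGY STARVATION BARRIER, GENERAL FORM.**  For every KP network proper `α ∈ E₂(R)` of the starved class (pockets `Q` forward-dead and
pump-dead; live modes with any diagonal forward network among themselves, leaking and pumping into the pockets only; no differential triads)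
whose exits GRAM-DOMINATE the onward feeds with a margin `r > ε₀` (`r·Σ_{e∉Q} w_{ae}w_{ce} ≤ Σ_{d∈Q}(P a d·P c d + w_{ad}w_{cd})` for live
`a, c`; `P ≥ 0`): `ShellBarrierAt R ε₀ α` with `(1+ε₀)^{2θ} = 1 + r` and `D = (1+r)²`, at EVERY scale ratio `1 + ε₀ > 1`.
MODEL lattice statement; a corner of the registered stubs, not the stubs. [cite: Tao2016AveragedNS, §4 (4.13)] -/
theorem starvedNetwork_shellBarrierAt {α : Fin 4 → Fin 4 → Fin 4 → ℤ × ℤ × ℤ → ℝ} {P : Fin 4 → Fin 4 → ℝ} {Q : Finset (Fin 4)}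
    {ε₀ r : ℝ} (hε : 0 < ε₀) (hPnn : ∀ a d, 0 ≤ P a d) (hgap : ε₀ < r)
    (hGram : ∀ a c : Fin 4, a ∉ Q → c ∉ Q →
      r * ∑ e ∈ Qᶜ, α a a e (0, 0, 1) * α c c e (0, 0, 1) ≤
        ∑ d ∈ Q, (P a d * P c d + α a a d (0, 0, 1) * α c c d (0, 0, 1)))
    (hD : ∀ a b i : Fin 4, a ≠ b → α a b i (0, 0, 1) = 0)
    (hPump : ∀ a d : Fin 4, α a a d (0, 0, 0) = P a d)
    (hCz : ∀ a b d : Fin 4, a ≠ b → a ≠ d → b ≠ d → α a b d (0, 0, 0) = 0)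
    (hQw : ∀ d ∈ Q, ∀ e : Fin 4, α d d e (0, 0, 1) = 0)
    (hQP : ∀ d ∈ Q, ∀ j : Fin 4, P d j = 0)
    (hPQ : ∀ a j : Fin 4, j ∉ Q → P a j = 0) (R : ℝ) :
    ShellBarrierAt R ε₀ α := by
  intro hT hO
  have hs : IsSymmetricCoeff α := hT.1
  have hc : IsCancellingCoeff α := hT.2.1
  have hr00 : 0 ≤ r := by linarith
  have hr0 : 0 < 1 + r := by linarith
  have hb1 : (1 : ℝ) < 1 + ε₀ := by linarith
  have hb0 : (0 : ℝ) < 1 + ε₀ := by linarith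
  have hrb : 1 + ε₀ < 1 + r := by linarith
  set θ : ℝ := Real.logb (1 + ε₀) (1 + r) / 2 with hθ
  have hθhalf : 1 / 2 < θ := by
    have : 1 < Real.logb (1 + ε₀) (1 + r) := by
      rw [Real.lt_logb_iff_rpow_lt hb1 hr0, Real.rpow_one]
      exact hrb
    simp only [hθ]
    linarith
  have hpow : (1 + ε₀) ^ (2 * θ) = 1 + r := by
    have : 2 * θ = Real.logb (1 + ε₀) (1 + r) := by simp only [hθ]; ring
    rw [this, Real.rpow_logb hb0 hb1.ne' hr0]
  refine ⟨θ, hθhalf, (1 + r) ^ 2, by positivity, ?_⟩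
  intro ν hν X₀ s _hs X hX0 hXneg _hM hXc hXd hXpos t ht i k
  set E₀ : ℝ := ∑ j : Fin 4, (1 / 2 : ℝ) * X₀ j ^ 2 with hE₀
  have hE₀0 : 0 ≤ E₀ := Finset.sum_nonneg fun j _ => by positivity
  have hq1 : (1 + r) * (1 + r)⁻¹ = 1 := mul_inv_cancel₀ hr0.ne'
  have hshell : ∑ j : Fin 4, (1 / 2 : ℝ) * X j (k : ℤ) t ^ 2 ≤ E₀ * (1 + r) ^ 2 * ((1 + r)⁻¹) ^ k := by
    cases k with
    | zero =>
      have h := kpProper_lowEnergy_le hs hc hO hD hb0 hν.le hX0 hXneg hXc hXd hXpos 0 t ht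
      rw [Finset.range_one, Finset.sum_singleton] at h
      have h1 : E₀ ≤ E₀ * (1 + r) ^ 2 * ((1 + r)⁻¹) ^ 0 := by
        rw [pow_zero, mul_one]
        have h1r : (1 : ℝ) ≤ (1 + r) ^ 2 := one_le_pow₀ (by linarith)
        nlinarith
      exact h.trans h1
    | succ m =>
      have hband := kpProper_bandEnergy_le_gateFlux hs hc hO hD hb0 hν.le hX0 hXneg hXc hXd hXpos
        (m := m) (N := m + 1) (by omega) t ht
      rw [Finset.Icc_self, Finset.sum_singleton] at hband
      have hflux := starved_gateFlux_le hs hc hO hD hPump hCz hQw hQP hPQ hε.le hν.le hr00 hPnn hGram hX0 hXneg hXc hXd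
        hXpos m t ht
      have heq : E₀ * (1 + r) * ((1 + r)⁻¹) ^ m = E₀ * (1 + r) ^ 2 * ((1 + r)⁻¹) ^ (m + 1) := by
        rw [pow_succ ((1 + r)⁻¹) m, show E₀ * (1 + r) ^ 2 * (((1 + r)⁻¹) ^ m * (1 + r)⁻¹) =
          E₀ * (1 + r) * ((1 + r)⁻¹) ^ m * ((1 + r) * (1 + r)⁻¹) by ring, hq1, mul_one]
      calc ∑ j : Fin 4, (1 / 2 : ℝ) * X j ((m + 1 : ℕ) : ℤ) t ^ 2 ≤ _ := hband
        _ ≤ E₀ * (1 + r) * ((1 + r)⁻¹) ^ m := hflux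
        _ = _ := heq
  have hsingle : (1 / 2 : ℝ) * X i (k : ℤ) t ^ 2 ≤ ∑ j : Fin 4, (1 / 2 : ℝ) * X j (k : ℤ) t ^ 2 :=
    Finset.single_le_sum (f := fun j => (1 / 2 : ℝ) * X j (k : ℤ) t ^ 2) (fun j _ => by positivity)
      (Finset.mem_univ i)
  have hweight : (1 + ε₀) ^ (2 * θ * (k : ℝ)) = (1 + r) ^ k := by
    rw [Real.rpow_mul hb0.le, hpow, Real.rpow_natCast]
  rw [hweight]
  calc (1 + r) ^ k * ((1 / 2 : ℝ) * X i (k : ℤ) t ^ 2) ≤ (1 + r) ^ k * (E₀ * (1 + r) ^ 2 * ((1 + r)⁻¹) ^ k) :=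
        mul_le_mul_of_nonneg_left (hsingle.trans hshell) (pow_nonneg hr0.le k)
    _ = (1 + r) ^ 2 * E₀ := by
        rw [show (1 + r) ^ k * (E₀ * (1 + r) ^ 2 * ((1 + r)⁻¹) ^ k) =
          (1 + r) ^ 2 * E₀ * ((1 + r) * (1 + r)⁻¹) ^ k by rw [mul_pow]; ring, hq1, one_pow, mul_one]

/-- **Tail ceiling** for the starved class (`CeilingAt R ε₀ α`). MODEL lattice statement. [cite: Tao2016AveragedNS, §4 (4.13)] -/
theorem starvedNetwork_ceilingAt {α : Fin 4 → Fin 4 → Fin 4 → ℤ × ℤ × ℤ → ℝ} {P : Fin 4 → Fin 4 → ℝ} {Q : Finset (Fin 4)}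
    {ε₀ r : ℝ} (hε : 0 < ε₀) (hPnn : ∀ a d, 0 ≤ P a d) (hgap : ε₀ < r)
    (hGram : ∀ a c : Fin 4, a ∉ Q → c ∉ Q →
      r * ∑ e ∈ Qᶜ, α a a e (0, 0, 1) * α c c e (0, 0, 1) ≤
        ∑ d ∈ Q, (P a d * P c d + α a a d (0, 0, 1) * α c c d (0, 0, 1)))
    (hD : ∀ a b i : Fin 4, a ≠ b → α a b i (0, 0, 1) = 0)
    (hPump : ∀ a d : Fin 4, α a a d (0, 0, 0) = P a d)
    (hCz : ∀ a b d : Fin 4, a ≠ b → a ≠ d → b ≠ d → α a b d (0, 0, 0) = 0)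
    (hQw : ∀ d ∈ Q, ∀ e : Fin 4, α d d e (0, 0, 1) = 0)
    (hQP : ∀ d ∈ Q, ∀ j : Fin 4, P d j = 0)
    (hPQ : ∀ a j : Fin 4, j ∉ Q → P a j = 0) (R : ℝ) :
    CeilingAt R ε₀ α :=
  subOnsagerCeiling_ceilingAt_of_shellBarrierAt hε
    (starvedNetwork_shellBarrierAt hε hPnn hgap hGram hD hPump hCz hQw hQP hPQ R)

/-- **The registered stubs' currency**: the body of the skeleton's `PrimaryGradedAt R ε₀ α` (verbatim) for every starved network with Gram
margin `r > ε₀`, at every scale ratio. MODEL lattice statement; a corner of BOTH registered stubs, not the stubs. [cite: Tao2016AveragedNS, §4 (4.13)] -/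
theorem starvedNetwork_primaryGraded {α : Fin 4 → Fin 4 → Fin 4 → ℤ × ℤ × ℤ → ℝ} {P : Fin 4 → Fin 4 → ℝ} {Q : Finset (Fin 4)}
    {ε₀ r : ℝ} (hε : 0 < ε₀) (hPnn : ∀ a d, 0 ≤ P a d) (hgap : ε₀ < r)
    (hGram : ∀ a c : Fin 4, a ∉ Q → c ∉ Q →
      r * ∑ e ∈ Qᶜ, α a a e (0, 0, 1) * α c c e (0, 0, 1) ≤
        ∑ d ∈ Q, (P a d * P c d + α a a d (0, 0, 1) * α c c d (0, 0, 1)))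
    (hD : ∀ a b i : Fin 4, a ≠ b → α a b i (0, 0, 1) = 0)
    (hPump : ∀ a d : Fin 4, α a a d (0, 0, 0) = P a d)
    (hCz : ∀ a b d : Fin 4, a ≠ b → a ≠ d → b ≠ d → α a b d (0, 0, 0) = 0)
    (hQw : ∀ d ∈ Q, ∀ e : Fin 4, α d d e (0, 0, 1) = 0)
    (hQP : ∀ d ∈ Q, ∀ j : Fin 4, P d j = 0)
    (hPQ : ∀ a j : Fin 4, j ∉ Q → P a j = 0) (R : ℝ) :
    Literature.Analysis.FluidPDE.TaoCascade.InTableClass R α →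
      (∀ (Y : Fin 4 → ℤ → ℝ → ℝ) (τ : ℝ), (∀ (j : Fin 4) (k : ℤ), 1 ≤ k → 0 ≤ Y j k τ) → ∀ δ : ℝ, 0 < δ →
        ∀ (i : Fin 4) (n : ℤ), 1 ≤ n → Y i n τ = 0 → 0 ≤ Literature.Analysis.FluidPDE.TaoCascade.quadTerm δ α Y i n τ) →
      (∀ a b i : Fin 4, a ≠ b → α a b i (0, 0, 1) = 0) →
      ∃ (lev : Fin 4 → ℕ) (L : ℕ), (∀ a, lev a ≤ L) ∧
        (∀ a, lev a ≠ 0 → (∃ e, α a a e (0, 0, 1) ≠ 0) →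
          (∀ j, α j j a (0, 0, 1) ≠ 0 → lev j < lev a ∧ (lev j = 0 ∨ ∃ e', α j j e' (0, 0, 1) ≠ 0)) ∧
          (∀ i₁ i₂, i₁ ≠ a → i₂ ≠ a → α i₁ i₂ a (0, 0, 0) ≠ 0 →
            (lev i₁ < lev a ∧ (lev i₁ = 0 ∨ ∃ e', α i₁ i₁ e' (0, 0, 1) ≠ 0)) ∧
            (lev i₂ < lev a ∧ (lev i₂ = 0 ∨ ∃ e', α i₂ i₂ e' (0, 0, 1) ≠ 0))) ∧
          (∃ e, α a a e (0, 0, 1) ≠ 0 ∧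
            (∀ j, α e e j (0, 0, 1) ≠ 0 → lev j < lev a ∧ (lev j = 0 ∨ ∃ e', α j j e' (0, 0, 1) ≠ 0)) ∧
            (∀ j, j ≠ e → α e e j (0, 0, 0) ≠ 0 →
              lev j < lev a ∧ (lev j = 0 ∨ ∃ e', α j j e' (0, 0, 1) ≠ 0)))) ∧
        ∃ θ : ℝ, 1 / 2 < θ ∧ θ ≤ 1 ∧ ∃ D : ℝ, 0 ≤ D ∧
          ∀ ν : ℝ, 0 < ν → ∀ (X₀ : Fin 4 → ℝ) (s : ℝ), 0 < s → ∀ X : Fin 4 → ℤ → ℝ → ℝ,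
          (∀ (i : Fin 4) (k : ℤ), X i k 0 = if k = 0 then X₀ i else 0) →
          (∀ (i : Fin 4) (k : ℤ), k < 0 → ∀ t : ℝ, X i k t = 0) →
          (∃ M : ℝ, ∀ (t : ℝ) (i : Fin 4) (k : ℤ), (1 + (1 + ε₀) ^ ((10 : ℝ) * k)) * |X i k t| ≤ M) →
          (∀ (i : Fin 4) (k : ℤ), Continuous (X i k)) →
          (∀ (i : Fin 4) (k : ℤ), ∀ t ∈ Set.Icc (0 : ℝ) s, HasDerivWithinAt (X i k)
            (Literature.Analysis.FluidPDE.TaoCascade.quadTerm ε₀ α X i k t - ν * (1 + ε₀) ^ ((2 : ℝ) * k) * X i k t)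
            (Set.Icc (0 : ℝ) s) t) →
          (∀ t ∈ Set.Icc (0 : ℝ) s, ∀ (i : Fin 4) (k : ℤ), 1 ≤ k → 0 ≤ X i k t) →
          ∀ t ∈ Set.Icc (0 : ℝ) s, ∀ i, lev i = 0 → ∀ k : ℕ,
            (1 + ε₀) ^ (2 * θ * (k : ℝ)) * ((1 / 2 : ℝ) * X i (k : ℤ) t ^ 2) ≤
              D * (∑ j : Fin 4, (1 / 2 : ℝ) * X₀ j ^ 2) :=
  kpPrimaryGraded_of_shellBarrierAt hε (starvedNetwork_shellBarrierAt hε hPnn hgap hGram hD hPump hCz hQw hQP hPQ R)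

end Summit.NavierStokesRegularity.NavierStokesRegularity.Theorems

end
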